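import Summits.Parity.GeneralizedHardyLittlewood.Theorems.PrimeLevelFamEdgeMomentsBeyondDiagonalFirstOrderDiagGamma
import Literature.NumberTheory.LFunctions.KMVFirstMomentBeyondDiagonal
import HarnessLib

/-!
# Bridge: the complete diagonal of the order-`j` mollified first moment as `Σ_i (j choose i) γ_{j−i} D_i(M)`
# (helper for crux K_A `PrimeLevelFamEdge.MomentsBeyondDiagonal`, stmt-Parity-20007, stub `stub_first : SubFirst` ∀`Q`)

`…FirstOrderMollifiedK.harmonicSum_derivLambda_mul_mollifierP_sub_complete_le` leaves the diagonal
`Σ_{m ≤ M} x_m m^{−1/2} 𝒱_j(log(q̂/m))`; `…FirstOrderDiagAsymp.diagSum_mul_sq_log_sub_le` evaluates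
`D_i(M) = Σ_{m ≤ M} μ(m)ψ(m)⁻¹m⁻¹ P(log(M/m)/log M)(log(M/m) − a)^i`. This file is the exact identity between them
(`mollifierDiag_eq_sum_choose`): `x_m m^{−1/2} = μ(m)ψ(m)⁻¹m⁻¹P(·)`, `𝒱_j = Σ_i (j choose i) γ_{j−i} logⁱ(q̂/m)`
(`integral_expLogPow_eq_sum_choose`) and `log(q̂/m) = log(M/m) − (log M − log q̂)` (so `a = log M − log q̂ = (Δ'−1) log q̂` at
`M = q̂^{Δ'}`). Proof only; nothing about Landau–Siegel zeros; K_A NOT proved.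
-/

noncomputable section

open scoped Real
open Set MeasureTheory Finset Polynomial
open Literature.NumberTheory.LFunctions Literature.NumberTheory.LFunctions.KMV2000

namespace Summit.Parity.GeneralizedHardyLittlewood.Theorems.MomentsBeyondDiagonal.FirstOrderAFE

/-- **Bridge identity.** For a real polynomial `P`, `M > 0`, `q̂ > 0` and `j`:
`Σ_{m ≤ M} x_m m^{−1/2} ∫_0^∞ e^{−x}(log(q̂/m) + log x)^j dx
 = Σ_{i ≤ j} (j choose i) γ_{j−i} Σ_{m ≤ M} μ(m)ψ(m)⁻¹m⁻¹ P(log(M/m)/log M)(log(M/m) − (log M − log q̂))^i`,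
`γ_l = ∫_0^∞ e^{−x}(log x)^l dx`. [cite: KowalskiMichelVanderKam2000, §4 (16), (19)–(20)] -/
theorem mollifierDiag_eq_sum_choose (P : ℝ[X]) {M qh : ℝ} (hM : 0 < M) (hqh : 0 < qh) (j : ℕ) :
    ∑ m ∈ Finset.Icc 1 ⌊M⌋₊, mollifierCoeff P M m * (m : ℝ) ^ (-(1 / 2 : ℝ)) *
        ∫ x in Ioi (0 : ℝ), Real.exp (-x) * (Real.log (qh / m) + Real.log x) ^ j =
      ∑ i ∈ range (j + 1), ((j.choose i : ℕ) : ℝ) * (∫ x in Ioi (0 : ℝ), Real.exp (-x) * (Real.log x) ^ (j - i)) *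
        ∑ m ∈ Finset.Icc 1 ⌊M⌋₊, (ArithmeticFunction.moebius m : ℝ) * ((psi m)⁻¹ * (m : ℝ)⁻¹) *
          P.eval (Real.log (M / m) / Real.log M) * (Real.log (M / m) - (Real.log M - Real.log qh)) ^ i := by
  have hm : ∀ m ∈ Finset.Icc 1 ⌊M⌋₊, mollifierCoeff P M m * (m : ℝ) ^ (-(1 / 2 : ℝ)) *
      ∫ x in Ioi (0 : ℝ), Real.exp (-x) * (Real.log (qh / m) + Real.log x) ^ j =
      ∑ i ∈ range (j + 1), ((j.choose i : ℕ) : ℝ) * (∫ x in Ioi (0 : ℝ), Real.exp (-x) * (Real.log x) ^ (j - i)) *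
        ((ArithmeticFunction.moebius m : ℝ) * ((psi m)⁻¹ * (m : ℝ)⁻¹) *
          P.eval (Real.log (M / m) / Real.log M) * (Real.log (M / m) - (Real.log M - Real.log qh)) ^ i) := by
    intro m hmI
    have hm1 : 1 ≤ m := (Finset.mem_Icc.1 hmI).1
    have hm0 : (0 : ℝ) < m := by exact_mod_cast hm1
    have hlog : Real.log (qh / m) = Real.log (M / m) - (Real.log M - Real.log qh) := by
      rw [Real.log_div hqh.ne' hm0.ne', Real.log_div hM.ne' hm0.ne']; ring
    have hpow : (m : ℝ) ^ (-(1 / 2 : ℝ)) * (m : ℝ) ^ (-(1 / 2 : ℝ)) = (m : ℝ)⁻¹ := by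
      rw [← Real.rpow_add hm0, show (-(1 / 2 : ℝ)) + -(1 / 2) = -1 by norm_num, Real.rpow_neg_one]
    rw [integral_expLogPow_eq_sum_choose (qh / m) j, hlog, Finset.mul_sum]
    refine Finset.sum_congr rfl fun i _ ↦ ?_
    unfold mollifierCoeff
    rw [← hpow]
    ring
  rw [Finset.sum_congr rfl hm, Finset.sum_comm]
  refine Finset.sum_congr rfl fun i _ ↦ ?_
  rw [Finset.mul_sum]

end Summit.Parity.GeneralizedHardyLittlewood.Theorems.MomentsBeyondDiagonal.FirstOrderAFE

end
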